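import Summits.KontsevichZagierPeriods.KontsevichZagierPeriods.Theses.HurwitzMicroSectors
import Literature.NumberTheory.Transcendental.KZLogCalculusProofs
import Literature.NumberTheory.Transcendental.KZHomotopyMoves
import Literature.NumberTheory.Transcendental.KZSemialgebraicComplex
import Literature.NumberTheory.Transcendental.SemialgebraicMapsProofs
import Literature.NumberTheory.Transcendental.KZUnfoldedStokesProofs

/-!
# `HurwitzSectorComplement` (stmt-KontsevichZagierPeriods-14341, route HurwitzMicroSectors),
# line `chebyshev-level-deformation`: stub `towerReduction_slab` — de-twisting a slab

A representation `r` on the twisted box `(0,1)^{n+2} × (0,α)` (`α > 0` real algebraic) whose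
integrand agrees there with `K(x₁,…,x_{n+2})` — a function of the first `n + 2` coordinates only,
`ℚ`-semialgebraic and integrable on the open unit box — is KZ-equivalent to the de-twisted box
representation `[(0,1)^{n+2}, α·K]`.

Route (moves only, all from the Literature calculus):
* ONE Newton–Leibniz move along the last coordinate (`KZ.exists_band_newtonLeibniz`): base
  `B = (0,1)^{n+2}`, bounds `0 ≤ α`, primitive `F(z) = z_last · K(init z)`, band integrand
  `f = K ∘ init = ∂F/∂z_last`, boundary term `F(x,α) − F(x,0) = α K x`; integrability of `f` on
  the CLOSED band comes from `r` itself (the closed band is `r.domain` plus the two null walls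
  `{z_last = 0}`, `{z_last = α}`, `KZ.volume_setOf_last_eq_zero`);
* open the fibres (`KZ.of_sub_of_restrict_openBand_mem_relations`): closed and open bands differ
  by a null set;
* congruence (`KZ.of_sub_of_mem_relations_of_eqOn`): the open band IS `r.domain` and the
  integrands agree on it.

References: M. Kontsevich, D. Zagier, *Periods* (2001), §1.2 rules (1), (3).
-/

noncomputable section

open Set MeasureTheory
open scoped BigOperators
open Literature.NumberTheory.Transcendental

namespace Summit.KontsevichZagierPeriods.Theorems.HurwitzMicroSectorsHurwitzSectorComplement

namespace TowerReductionSlab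

/-- **Integrability on the closed slab from the open one.** If `f` agrees with the integrand of a
representation `r` on `r.domain = (0,1)^{N} × (0,α)`, then `f` is integrable on the closed band
`(0,1)^{N} × [0,α]`: the difference is contained in the two null walls `{z_last = 0}`,
`{z_last = α}`. [cite: KontsevichZagier2001, §1.2 rule (1)] -/
theorem integrableOn_band_of_rep {N : ℕ} (α : ℝ) (f : (Fin (N + 1) → ℝ) → ℝ)
    (r : KZ.IntegralRep (N + 1))
    (hrd : r.domain = {z | (∀ i : Fin N, z (Fin.castSucc i) ∈ Ioo (0:ℝ) 1) ∧
      z (Fin.last N) ∈ Ioo 0 α})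
    (hri : EqOn r.integrand f r.domain) :
    IntegrableOn f (KZlog.band {x : Fin N → ℝ | ∀ i, x i ∈ Ioo (0:ℝ) 1} (fun _ => 0)
      (fun _ => α)) := by
  have h1 : IntegrableOn f r.domain :=
    r.integrableOn.congr_fun hri (KZ.IntegralRep.measurableSet_domain_holds r)
  have hnull : volume (KZlog.band {x : Fin N → ℝ | ∀ i, x i ∈ Ioo (0:ℝ) 1} (fun _ => 0)
      (fun _ => α) \ r.domain) = 0 := by
    refine measure_mono_null (t := {z | z (Fin.last N) = 0} ∪ {z | z (Fin.last N) = α}) ?_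
      (measure_union_null (KZ.volume_setOf_last_eq_zero 0) (KZ.volume_setOf_last_eq_zero α))
    rintro z ⟨⟨hzB, h0, hα⟩, hz2⟩
    rw [hrd] at hz2
    simp only [mem_setOf_eq, mem_Ioo, not_and, not_lt] at hz2
    rcases h0.eq_or_lt with h | h
    · exact Or.inl h.symm
    · exact Or.inr (le_antisymm hα (hz2 (fun i => hzB i) h))
  have h2 : IntegrableOn f (KZlog.band {x : Fin N → ℝ | ∀ i, x i ∈ Ioo (0:ℝ) 1} (fun _ => 0)
      (fun _ => α) \ r.domain) := IntegrableOn.of_measure_zero hnull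
  exact (h1.union h2).mono_set (by rw [union_sdiff_self]; exact subset_union_right)

/-- **The Newton–Leibniz move along the last coordinate** (rule (3)) over the open unit box
`B = (0,1)^{N}` with constant bounds `0 ≤ α`, primitive `F(z) = z_last · K(init z)` and band
integrand `K ∘ init`: the closed-band representation `[B × [0,α], K ∘ init]` and the base
representation `[B, α K]` exist and differ by a relation.
[cite: KontsevichZagier2001, §1.2 rule (3)] -/
theorem exists_band_base {N : ℕ} (α : ℝ) (K : (Fin N → ℝ) → ℝ) (hα : IsAlgebraic ℚ α)
    (hα0 : 0 < α) (hK : IsSemialgebraicFunOn ℚ {x : Fin N → ℝ | ∀ i, x i ∈ Ioo (0:ℝ) 1} K)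
    (hKi : IntegrableOn K {x : Fin N → ℝ | ∀ i, x i ∈ Ioo (0:ℝ) 1})
    (hint : IntegrableOn (fun z : Fin (N + 1) → ℝ => K (Fin.init z))
      (KZlog.band {x : Fin N → ℝ | ∀ i, x i ∈ Ioo (0:ℝ) 1} (fun _ => 0) (fun _ => α))) :
    ∃ (rb : KZ.IntegralRep (N + 1)) (rd : KZ.IntegralRep N),
      rb.domain = KZlog.band {x : Fin N → ℝ | ∀ i, x i ∈ Ioo (0:ℝ) 1} (fun _ => 0) (fun _ => α) ∧
      (rb.integrand = fun z => K (Fin.init z)) ∧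
      rd.domain = {x : Fin N → ℝ | ∀ i, x i ∈ Ioo (0:ℝ) 1} ∧
      EqOn rd.integrand (fun x => α * K x) rd.domain ∧ KZ.of rb - KZ.of rd ∈ KZ.relations := by
  set B : Set (Fin N → ℝ) := {x | ∀ i, x i ∈ Ioo (0:ℝ) 1} with hB_def
  have hB : Literature.ModelTheory.ExponentialFields.IsSemialgebraic ℚ B :=
    KZ.isSemialgebraic_unitCube N
  have ha : IsSemialgebraicFunOn ℚ B (fun _ => (0:ℝ)) := by
    simpa using isSemialgebraicFunOn_ratCast hB 0
  have hb : IsSemialgebraicFunOn ℚ B (fun _ => α) := isSemialgebraicFunOn_const_of_isAlgebraic hB hα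
  have hab : ∀ x ∈ B, (fun _ => (0:ℝ)) x ≤ (fun _ => α) x := fun _ _ => hα0.le
  have hband : Literature.ModelTheory.ExponentialFields.IsSemialgebraic ℚ
      (KZlog.band B (fun _ => 0) (fun _ => α)) := KZlog.isSemialgebraic_band ha hb
  set F : (Fin (N + 1) → ℝ) → ℝ := fun z => z (Fin.last N) * K (Fin.init z) with hF_def
  set f : (Fin (N + 1) → ℝ) → ℝ := fun z => K (Fin.init z) with hf_def
  have hf : IsSemialgebraicFunOn ℚ (KZlog.band B (fun _ => 0) (fun _ => α)) f :=
    hK.comp_init_mono hband KZ.band_subset_setOf_init_mem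
  have hF : IsSemialgebraicFunOn ℚ (KZlog.band B (fun _ => 0) (fun _ => α)) F :=
    IsSemialgebraicFunOn.mul_holds (isSemialgebraicFunOn_apply hband (Fin.last N)) hf
  have hcont : ∀ x ∈ B, ContinuousOn (fun t : ℝ => F (Fin.snoc x t))
      (Icc ((fun _ => (0:ℝ)) x) ((fun _ => α) x)) := by
    intro x _
    simp only [hF_def, Fin.snoc_last, Fin.init_snoc]
    fun_prop
  have hder : ∀ x ∈ B, ∀ t ∈ Ioo ((fun _ => (0:ℝ)) x) ((fun _ => α) x),
      HasDerivAt (fun t : ℝ => F (Fin.snoc x t)) (f (Fin.snoc x t)) t := by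
    intro x _ t _
    simp only [hF_def, hf_def, Fin.snoc_last, Fin.init_snoc]
    exact hasDerivAt_mul_const _
  have hds_eq : (fun x => F (Fin.snoc x ((fun _ => α) x)) - F (Fin.snoc x ((fun _ => (0:ℝ)) x))) =
      fun x => α * K x := by
    funext x
    simp only [hF_def, Fin.snoc_last, Fin.init_snoc]
    ring
  have hds : IsSemialgebraicFunOn ℚ B
      (fun x => F (Fin.snoc x ((fun _ => α) x)) - F (Fin.snoc x ((fun _ => (0:ℝ)) x))) := by
    rw [hds_eq]
    exact IsSemialgebraicFunOn.mul_holds hb hK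
  have hdi : IntegrableOn
      (fun x => F (Fin.snoc x ((fun _ => α) x)) - F (Fin.snoc x ((fun _ => (0:ℝ)) x))) B := by
    rw [hds_eq]
    exact hKi.const_mul α
  obtain ⟨rb, rd, hrbd, hrbi, hrdd, hrdi, hNL⟩ :=
    KZ.exists_band_newtonLeibniz hB _ _ ha hb hab F f hF hf hcont hder hint hds hdi
  refine ⟨rb, rd, hrbd, hrbi, hrdd, fun x _ => ?_, hNL⟩
  rw [hrdi, hds_eq]

end TowerReductionSlab

/-- **De-twisting a slab.** A representation on `(0,1)^{n+2} × (0,α)` (`α > 0` real algebraic)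
whose integrand is `K(x₁,…,x_{n+2})` there, `K` semialgebraic and integrable on the open unit box,
is KZ-equivalent to `[(0,1)^{n+2}, α·K]`: one Newton–Leibniz move along the last coordinate
(primitive `z_last · K`), the two null walls `{z_last = 0, α}`, and congruence.
[cite: KontsevichZagier2001, §1.2 rule (3)] -/
theorem towerReduction_slab : ∀ (n : ℕ) (α : ℝ) (K : (Fin (n + 2) → ℝ) → ℝ), IsAlgebraic ℚ α → 0 < α → IsSemialgebraicFunOn ℚ {x : Fin (n + 2) → ℝ | ∀ i, x i ∈ Set.Ioo (0:ℝ) 1} K → MeasureTheory.IntegrableOn K {x : Fin (n + 2) → ℝ | ∀ i, x i ∈ Set.Ioo (0:ℝ) 1} → ∀ (r : KZ.IntegralRep (n + 3)), r.domain = {z | (∀ i : Fin (n + 2), z (Fin.castSucc i) ∈ Set.Ioo (0:ℝ) 1) ∧ z (Fin.last (n + 2)) ∈ Set.Ioo 0 α} → Set.EqOn r.integrand (fun z => K (fun i => z (Fin.castSucc i))) r.domain → ∃ (r₀ : KZ.IntegralRep (n + 2)), r₀.domain = {x | ∀ i, x i ∈ Set.Ioo (0:ℝ) 1} ∧ Set.EqOn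 r₀.integrand (fun x => α * K x) r₀.domain ∧ KZ.Equivalent r r₀ := by
  intro n α K hα hα0 hK hKi r hrd hri
  -- `f = K ∘ init` is integrable on the closed band (it is `r.integrand` on `r.domain`)
  have hint : IntegrableOn (fun z : Fin (n + 2 + 1) → ℝ => K (Fin.init z))
      (KZlog.band {x : Fin (n + 2) → ℝ | ∀ i, x i ∈ Ioo (0:ℝ) 1} (fun _ => 0) (fun _ => α)) :=
    TowerReductionSlab.integrableOn_band_of_rep α _ r hrd hri
  -- the Newton–Leibniz move
  obtain ⟨rb, rd, hrbd, hrbi, hrdd, hrdi, hNL⟩ :=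
    TowerReductionSlab.exists_band_base α K hα hα0 hK hKi hint
  -- open the fibres
  have hB : Literature.ModelTheory.ExponentialFields.IsSemialgebraic ℚ
      {x : Fin (n + 2) → ℝ | ∀ i, x i ∈ Ioo (0:ℝ) 1} := KZ.isSemialgebraic_unitCube (n + 2)
  have ha : IsSemialgebraicFunOn ℚ {x : Fin (n + 2) → ℝ | ∀ i, x i ∈ Ioo (0:ℝ) 1}
      (fun _ => (0:ℝ)) := by
    simpa using isSemialgebraicFunOn_ratCast hB 0
  have hb : IsSemialgebraicFunOn ℚ {x : Fin (n + 2) → ℝ | ∀ i, x i ∈ Ioo (0:ℝ) 1} (fun _ => α) :=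
    isSemialgebraicFunOn_const_of_isAlgebraic hB hα
  obtain ⟨r', hr'd, hr'i, hopen⟩ := KZ.of_sub_of_restrict_openBand_mem_relations ha hb rb hrbd
  -- `r` versus `r'`: same domain, integrands agree on it
  have hrr' : KZ.of r - KZ.of r' ∈ KZ.relations := by
    refine KZ.of_sub_of_mem_relations_of_eqOn ?_ fun z hz => ?_
    · rw [hr'd, hrd]
      exact Set.ext fun _ => Iff.rfl
    · rw [hri hz, hr'i, hrbi]
      rfl
  refine ⟨rd, hrdd, hrdi, ?_⟩
  show KZ.of r - KZ.of rd ∈ KZ.relations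
  have : KZ.of r - KZ.of rd =
      (KZ.of r - KZ.of r') - (KZ.of rb - KZ.of r') + (KZ.of rb - KZ.of rd) := by abel
  rw [this]
  exact KZ.relations.add_mem (KZ.relations.sub_mem hrr' hopen) hNL

end Summit.KontsevichZagierPeriods.Theorems.HurwitzMicroSectorsHurwitzSectorComplement

end
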